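import Mathlib
import HarnessLib

/-!
# Analytic characteristic functions have exponential moments (Lukacs; Landau–Pringsheim)

Topic: probability / moments; one complex variable. Let `ν` be a finite measure on `ℝ` with
characteristic function `φ(b) = ∫ e^{ibx} dν(x)` (Mathlib's `MeasureTheory.charFun ν b`), and
suppose that `φ` agrees on the real interval `(-t, t)` with a function `f` holomorphic on the
complex disc `|z| < t` and bounded there by `M`. Then

* all even moments are finite, with the Cauchy-estimate bound
  `∫ x^{2k} dν ≤ (2k)! · M / r^{2k}` for every `0 < r < t` (`lintegral_pow_le_of_charFun_eq`);
* `ν` has exponential moments of every order `σ` with `|σ| < t`: `∫ e^{σx} dν < ∞`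
  (`lintegral_exp_mul_lt_top_of_charFun_eq`, `integrable_exp_mul_of_charFun_eq`), i.e.
  `(-t, t) ⊆ integrableExpSet id ν` (`Ioo_subset_integrableExpSet_of_charFun_eq`);
* consequently the complex moment generating function `z ↦ ∫ e^{zx} dν`
  (`ProbabilityTheory.complexMGF id ν`) is holomorphic on the strip `|Re z| < t`, and
  `β ↦ complexMGF id ν (β I)` IS the holomorphic function `f` on the disc
  (`complexMGF_mul_I_eq_of_charFun_eq`, identity theorem along the real diameter); in particular
  `∫ e^{σx} dν = f(-iσ) ≤ M` for `|σ| < t` (`mgf_le_of_charFun_eq`,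
  `lintegral_exp_mul_le_of_charFun_eq`, `integral_exp_mul_le_of_charFun_eq`).

This is the theorem of Lukacs (*Characteristic Functions*, 2nd ed. 1970, Thm. 7.1.1): a
characteristic function which coincides near `0` with (the restriction of) a function analytic in
a disc is analytic in the corresponding horizontal strip, and the distribution has exponential
moments there; the radius statement is the Landau–Pringsheim phenomenon for Laplace transforms of
positive measures.

## Proof

We avoid Lukacs' induction on the order of the moments. For `h > 0` the `2k`-th central
difference of `φ` with step `h` is the integral of a nonnegative function,

  `Σ_{j=0}^{2k} (-1)^{2k-j} (2k choose j) φ((j-k)h) = ∫ e^{-ikhx} (e^{ihx} - 1)^{2k} dν(x)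
      = (-1)^k ∫ (2 - 2 cos (hx))^k dν(x)`

(`sum_centralDiff_charFun`, from Mathlib's `fwdDiff_addChar_eq`). On the other side, expanding
the holomorphic `f(z) = Σ aₙ zⁿ` (`Complex.hasSum_taylorSeries_on_ball`) gives
`Σ_j (-1)^{2k-j} (2k choose j) f((j-k)h) = Σₙ aₙ hⁿ Δ₁^{2k}[sⁿ](-k)`, where the `2k`-th forward
difference of the monomial `sⁿ` vanishes for `n < 2k`, equals `(2k)!` for `n = 2k` (Mathlib's
`fwdDiff_iter_pow_eq_zero_of_lt`, `fwdDiff_iter_eq_factorial`) and has modulus at most `4^k kⁿ`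
for `n > 2k`; with the Cauchy estimates `|aₙ| ≤ M / rⁿ`
(`Complex.norm_iteratedDeriv_le_of_forall_mem_sphere_norm_le`) this yields
`|Σ_j … f((j-k)h)| ≤ h^{2k} ((2k)! M / r^{2k} + C_k h)` (`norm_sum_centralDiff_le`). Since
`((2 - 2cos(hx))/h²)^k → x^{2k}` as `h → 0⁺`, Fatou's lemma (`lintegral_liminf_le'`) gives the
moment bound; summing the `cosh` series (`Real.hasSum_cosh`) gives the exponential moments;
Mathlib's `analyticOnNhd_complexMGF` and the identity theorem
`AnalyticOnNhd.eqOn_of_preconnected_of_frequently_eq` give the identification.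

## Mathlib

We USE `MeasureTheory.charFun`, `ProbabilityTheory.complexMGF`, `ProbabilityTheory.mgf`,
`ProbabilityTheory.integrableExpSet`, `ProbabilityTheory.analyticOnNhd_complexMGF`, `fwdDiff`
and its polynomial lemmas (`Mathlib/Algebra/Group/ForwardDiff.lean`),
`Complex.hasSum_taylorSeries_on_ball`, the Cauchy estimates of
`Mathlib/Analysis/Complex/Liouville.lean`, `lintegral_liminf_le'`, `Real.hasSum_cosh`. Mathlib has
the direction "exponential moments ⇒ holomorphic `complexMGF`" (`Mathlib/Probability/Moments/`)
but not this converse (searched `charFun.*analytic`, `Pringsheim`, `Lukacs`, `integrableExpSet`).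
No definitions are introduced.

## References

* E. Lukacs, *Characteristic Functions*, 2nd ed., Griffin, London (1970), Thm. 7.1.1, §7.2.
* D. V. Widder, *The Laplace Transform*, Princeton (1941), Ch. II §5 (Landau–Pringsheim:
  the real point of the abscissa of convergence is singular for positive measures).
-/

noncomputable section

open Set Filter Metric
open _root_.MeasureTheory _root_.ProbabilityTheory
open scoped ENNReal NNReal Topology Nat fwdDiff

namespace Literature.Probability.Moments

/-! ## The measure side: central differences of a characteristic function -/

/-- The Fourier kernel `x ↦ e^{ibx}` is integrable against a finite measure on `ℝ`. [folklore] -/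
theorem integrable_cexp_mul_I (ν : Measure ℝ) [IsFiniteMeasure ν] (b : ℝ) :
    Integrable (fun x : ℝ => Complex.exp (b * x * Complex.I)) ν := by
  refine (integrable_const (1 : ℝ)).mono' (Continuous.aestronglyMeasurable (by fun_prop))
    (ae_of_all _ fun x => ?_)
  rw [← Complex.ofReal_mul, Complex.norm_exp_ofReal_mul_I]

/-- **Central differences of a characteristic function.** For a finite measure `ν` on `ℝ` with
characteristic function `φ = charFun ν`, a step `h : ℝ` and `k : ℕ`,
`Σ_{j=0}^{2k} (-1)^{2k-j} (2k choose j) φ((j-k)h) = (-1)^k ∫ (2 - 2cos(hx))^k dν(x)`,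
because `Σ_j (-1)^{2k-j} (2k choose j) e^{i(j-k)hx} = e^{-ikhx}(e^{ihx} - 1)^{2k} = (2cos(hx) - 2)^k`
(the `2k`-th forward difference of the additive character `b ↦ e^{ibx}`, Mathlib's
`fwdDiff_addChar_eq`). In particular the central difference is real, of sign `(-1)^k`.
(Lukacs, *Characteristic Functions* (1970), proof of Thm. 7.1.1, uses the case `k = 1`
repeatedly.) [folklore] -/
theorem sum_centralDiff_charFun (ν : Measure ℝ) [IsFiniteMeasure ν] (h : ℝ) (k : ℕ) :
    ∑ j ∈ Finset.range (2 * k + 1), ((-1 : ℂ) ^ (2 * k - j) * ((2 * k).choose j : ℂ)) *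
        charFun ν (((j : ℝ) - k) * h) =
      (-1) ^ k * ((∫ x, (2 - 2 * Real.cos (h * x)) ^ k ∂ν : ℝ) : ℂ) := by
  -- the pointwise trigonometric identity, via the additive character `b ↦ e^{ibx}`
  have hpt : ∀ x : ℝ,
      ∑ j ∈ Finset.range (2 * k + 1), ((-1 : ℂ) ^ (2 * k - j) * ((2 * k).choose j : ℂ)) *
          Complex.exp ((((j : ℝ) - k) * h : ℝ) * x * Complex.I) =
        (-1) ^ k * (((2 - 2 * Real.cos (h * x)) ^ k : ℝ) : ℂ) := by
    intro x
    let ψ : AddChar ℝ ℂ :=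
      { toFun := fun b => Complex.exp (b * x * Complex.I)
        map_zero_eq_one' := by simp
        map_add_eq_mul' := fun a b => by
          rw [← Complex.exp_add]
          congr 1
          push_cast
          ring }
    have hψ : ∀ b : ℝ, ψ b = Complex.exp (b * x * Complex.I) := fun b => rfl
    have h1 := fwdDiff_addChar_eq ψ (-(k : ℝ) * h) h (2 * k)
    rw [fwdDiff_iter_eq_sum_shift] at h1
    simp only [hψ, zsmul_eq_mul, Int.cast_mul, Int.cast_pow, Int.cast_neg, Int.cast_one,
      Int.cast_natCast] at h1
    have h2 : ∀ j : ℕ, Complex.exp (((-(k : ℝ) * h + j • h : ℝ) : ℂ) * x * Complex.I) =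
        Complex.exp ((((j : ℝ) - k) * h : ℝ) * x * Complex.I) := by
      intro j
      congr 1
      push_cast [nsmul_eq_mul]
      ring
    simp_rw [h2] at h1
    rw [h1]
    have h3 : Complex.exp (((-(k : ℝ) * h : ℝ) : ℂ) * x * Complex.I) =
        Complex.exp (-(((h * x : ℝ) : ℂ) * Complex.I)) ^ k := by
      rw [← Complex.exp_nat_mul]
      congr 1
      push_cast
      ring
    have h4 : Complex.exp ((h : ℂ) * x * Complex.I) = Complex.exp (((h * x : ℝ) : ℂ) * Complex.I) := by
      push_cast
      ring_nf
    have h5 : Complex.exp (((h * x : ℝ) : ℂ) * Complex.I) *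
        Complex.exp (-(((h * x : ℝ) : ℂ) * Complex.I)) = 1 := by
      rw [← Complex.exp_add, add_neg_cancel, Complex.exp_zero]
    have hcos := Complex.two_cos ((h * x : ℝ) : ℂ)
    rw [neg_mul] at hcos
    have h6 : (Complex.exp (((h * x : ℝ) : ℂ) * Complex.I) - 1) ^ 2 *
          Complex.exp (-(((h * x : ℝ) : ℂ) * Complex.I)) =
        -(2 - 2 * Complex.cos ((h * x : ℝ) : ℂ)) := by
      linear_combination (Complex.exp (((h * x : ℝ) : ℂ) * Complex.I) - 2) * h5 - hcos
    rw [h3, h4, pow_mul, ← mul_pow, h6, neg_pow]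
    push_cast
    ring
  calc ∑ j ∈ Finset.range (2 * k + 1), ((-1 : ℂ) ^ (2 * k - j) * ((2 * k).choose j : ℂ)) *
          charFun ν (((j : ℝ) - k) * h)
      = ∫ x, ∑ j ∈ Finset.range (2 * k + 1),
          ((-1 : ℂ) ^ (2 * k - j) * ((2 * k).choose j : ℂ)) *
            Complex.exp ((((j : ℝ) - k) * h : ℝ) * x * Complex.I) ∂ν := by
        rw [integral_finsetSum _ fun j _ => (integrable_cexp_mul_I ν _).const_mul _]
        refine Finset.sum_congr rfl fun j _ => ?_
        rw [integral_const_mul, charFun_apply_real]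
    _ = ∫ x, (-1 : ℂ) ^ k * (((2 - 2 * Real.cos (h * x)) ^ k : ℝ) : ℂ) ∂ν :=
        integral_congr_ae (Eventually.of_forall hpt)
    _ = (-1) ^ k * ((∫ x, (2 - 2 * Real.cos (h * x)) ^ k ∂ν : ℝ) : ℂ) := by
        rw [integral_const_mul, integral_complex_ofReal]

/-! ## The analytic side: central differences of a bounded holomorphic function -/

/-- The sample points `(j - k) h`, `0 ≤ j ≤ 2k`, of a central difference of order `2k` with step
`h ≥ 0` lie in `[-kh, kh]`. [folklore] -/
theorem abs_sub_mul_le_of_mem_range {k j : ℕ} (hj : j ∈ Finset.range (2 * k + 1)) {h : ℝ}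
    (hh : 0 ≤ h) : |((j : ℝ) - k) * h| ≤ k * h := by
  have hj' : j ≤ 2 * k := Nat.lt_succ_iff.1 (Finset.mem_range.1 hj)
  have hj2 : (j : ℝ) ≤ 2 * k := by exact_mod_cast hj'
  have hj0 : (0 : ℝ) ≤ j := Nat.cast_nonneg j
  rw [abs_mul, abs_of_nonneg hh]
  exact mul_le_mul_of_nonneg_right (abs_le.2 ⟨by linarith, by linarith⟩) hh

/-- **Central differences of a bounded holomorphic function on a disc.** If `f` is holomorphic
on the disc `|z| < R` and bounded there by `M`, `0 < r < R`, then for `0 < h` with `2kh ≤ r` the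
`2k`-th central difference with step `h` at `0` satisfies
`|Σ_{j=0}^{2k} (-1)^{2k-j} (2k choose j) f((j-k)h)| ≤ h^{2k} ((2k)! M / r^{2k} + C h)` with
`C = 2 · 4^k M k^{2k+1} / r^{2k+1}`. Proof: insert the Taylor series `f(z) = Σ aₙ zⁿ`; the
coefficient of `aₙ hⁿ` is the `2k`-th forward difference of `sⁿ` at `-k`, which is `0` for
`n < 2k` and `(2k)!` for `n = 2k` (finite differences annihilate polynomials of lower degree),
and at most `4^k kⁿ` beyond; the Cauchy estimates `|aₙ| ≤ M/rⁿ` and a geometric series finish.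
[folklore] -/
theorem norm_sum_centralDiff_le {f : ℂ → ℂ} {R M r : ℝ} (hf : DifferentiableOn ℂ f (ball 0 R))
    (hM : ∀ z ∈ ball (0 : ℂ) R, ‖f z‖ ≤ M) (hr : 0 < r) (hrR : r < R) (k : ℕ) {h : ℝ}
    (hh : 0 < h) (hkh : 2 * k * h ≤ r) :
    ‖∑ j ∈ Finset.range (2 * k + 1), ((-1 : ℂ) ^ (2 * k - j) * ((2 * k).choose j : ℂ)) *
        f ((((j : ℝ) - k) * h : ℝ) : ℂ)‖ ≤
      h ^ (2 * k) * ((2 * k)! * M / r ^ (2 * k) +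
        2 * 4 ^ k * M * k ^ (2 * k + 1) / r ^ (2 * k + 1) * h) := by
  have hR : 0 < R := hr.trans hrR
  have hM0 : 0 ≤ M := (norm_nonneg _).trans (hM 0 (mem_ball_self hR))
  -- Cauchy estimates for the Taylor coefficients `a n = f⁽ⁿ⁾(0) / n!`
  have hcauchy : ∀ n : ℕ, ‖iteratedDeriv n f 0‖ ≤ n ! * M / r ^ n := fun n =>
    Complex.norm_iteratedDeriv_le_of_forall_mem_sphere_norm_le n hr
      (hf.diffContOnCl_ball (closedBall_subset_ball hrR))
      (fun z hz => hM z (closedBall_subset_ball hrR (sphere_subset_closedBall hz)))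
  obtain ⟨a, ha_def⟩ : ∃ a : ℕ → ℂ, a = fun n => ((n ! : ℕ) : ℂ)⁻¹ * iteratedDeriv n f 0 :=
    ⟨_, rfl⟩
  have ha : ∀ n, ‖a n‖ ≤ M / r ^ n := fun n => by
    have hn : (0 : ℝ) < n ! := by positivity
    calc ‖a n‖ = (n ! : ℝ)⁻¹ * ‖iteratedDeriv n f 0‖ := by
          rw [ha_def]
          dsimp only
          rw [norm_mul, norm_inv, Complex.norm_natCast]
      _ ≤ (n ! : ℝ)⁻¹ * (n ! * M / r ^ n) := mul_le_mul_of_nonneg_left (hcauchy n) (by positivity)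
      _ = M / r ^ n := by field_simp
  -- the sample points lie in the disc of radius `R`
  have hkh' : (k : ℝ) * h ≤ r / 2 := by linarith
  have hz_ball : ∀ j ∈ Finset.range (2 * k + 1),
      ((((j : ℝ) - k) * h : ℝ) : ℂ) ∈ ball (0 : ℂ) R := fun j hj => by
    rw [mem_ball_zero_iff, Complex.norm_real, Real.norm_eq_abs]
    linarith [abs_sub_mul_le_of_mem_range hj hh.le]
  -- Taylor expansions at the sample points
  have htaylor : ∀ j ∈ Finset.range (2 * k + 1),
      HasSum (fun n => a n * ((((j : ℝ) - k) * h : ℝ) : ℂ) ^ n)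
        (f ((((j : ℝ) - k) * h : ℝ) : ℂ)) := by
    intro j hj
    have := Complex.hasSum_taylorSeries_on_ball hf (hz_ball j hj)
    simp only [sub_zero, smul_eq_mul] at this
    have e : (fun n => a n * ((((j : ℝ) - k) * h : ℝ) : ℂ) ^ n) =
        fun n => ((n ! : ℕ) : ℂ)⁻¹ * (((((j : ℝ) - k) * h : ℝ) : ℂ) ^ n * iteratedDeriv n f 0) := by
      funext n
      simp only [ha_def]
      ring
    rw [e]
    exact this
  -- the combined series `Σ_n a n h^n P n`, `P n` the `2k`-th difference of `s ↦ s^n` at `-k`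
  obtain ⟨P, hP_def⟩ : ∃ P : ℕ → ℂ, P = fun n => ∑ j ∈ Finset.range (2 * k + 1),
      ((-1 : ℤ) ^ (2 * k - j) * ((2 * k).choose j : ℤ)) • (-(k : ℂ) + j • (1 : ℂ)) ^ n :=
    ⟨_, rfl⟩
  set S : ℂ := ∑ j ∈ Finset.range (2 * k + 1),
    ((-1 : ℂ) ^ (2 * k - j) * ((2 * k).choose j : ℂ)) * f ((((j : ℝ) - k) * h : ℝ) : ℂ) with hS
  have hzpow : ∀ j n : ℕ, ((((j : ℝ) - k) * h : ℝ) : ℂ) ^ n =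
      (h : ℂ) ^ n * (-(k : ℂ) + j • (1 : ℂ)) ^ n := by
    intro j n
    rw [← mul_pow]
    congr 1
    push_cast [nsmul_eq_mul]
    ring
  have hsum : HasSum (fun n => a n * h ^ n * P n) S := by
    have := hasSum_sum (s := Finset.range (2 * k + 1))
      (f := fun j n => ((-1 : ℂ) ^ (2 * k - j) * ((2 * k).choose j : ℂ)) *
        (a n * ((((j : ℝ) - k) * h : ℝ) : ℂ) ^ n))
      (a := fun j => ((-1 : ℂ) ^ (2 * k - j) * ((2 * k).choose j : ℂ)) *
        f ((((j : ℝ) - k) * h : ℝ) : ℂ))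
      fun j hj => (htaylor j hj).mul_left _
    have e : (fun n => a n * h ^ n * P n) = fun n => ∑ j ∈ Finset.range (2 * k + 1),
        ((-1 : ℂ) ^ (2 * k - j) * ((2 * k).choose j : ℂ)) *
          (a n * ((((j : ℝ) - k) * h : ℝ) : ℂ) ^ n) := by
      funext n
      rw [hP_def]
      dsimp only
      rw [Finset.mul_sum]
      refine Finset.sum_congr rfl fun j _ => ?_
      rw [hzpow j n, zsmul_eq_mul]
      push_cast
      ring
    rw [e]
    exact this
  -- values of `P`: zero below `2k`, `(2k)!` at `2k`, at most `4^k k^n` in general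
  have hP_lt : ∀ n, n < 2 * k → P n = 0 := fun n hn => by
    have := congr_fun (fwdDiff_iter_pow_eq_zero_of_lt (R := ℂ) hn) (-(k : ℂ))
    rw [fwdDiff_iter_eq_sum_shift, Pi.zero_apply] at this
    rw [hP_def]
    exact this
  have hP_eq : P (2 * k) = (2 * k)! := by
    have := congr_fun (fwdDiff_iter_eq_factorial (R := ℂ) (n := 2 * k)) (-(k : ℂ))
    rw [fwdDiff_iter_eq_sum_shift, Pi.natCast_apply] at this
    rw [hP_def]
    exact this
  have hP_le : ∀ n, ‖P n‖ ≤ 4 ^ k * k ^ n := fun n => by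
    rw [hP_def]
    dsimp only
    calc ‖∑ j ∈ Finset.range (2 * k + 1),
          ((-1 : ℤ) ^ (2 * k - j) * ((2 * k).choose j : ℤ)) • (-(k : ℂ) + j • (1 : ℂ)) ^ n‖
        ≤ ∑ j ∈ Finset.range (2 * k + 1),
          ‖((-1 : ℤ) ^ (2 * k - j) * ((2 * k).choose j : ℤ)) • (-(k : ℂ) + j • (1 : ℂ)) ^ n‖ :=
          norm_sum_le _ _
      _ ≤ ∑ j ∈ Finset.range (2 * k + 1), ((2 * k).choose j : ℝ) * k ^ n := by
          refine Finset.sum_le_sum fun j hj => ?_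
          have hc : ‖((((-1 : ℤ) ^ (2 * k - j) * ((2 * k).choose j : ℤ)) : ℤ) : ℂ)‖ =
              (2 * k).choose j := by
            push_cast
            rw [norm_mul, norm_pow, norm_neg, norm_one, one_pow, one_mul, Complex.norm_natCast]
          have hb : ‖-(k : ℂ) + j • (1 : ℂ)‖ ≤ k := by
            rw [nsmul_eq_mul, mul_one]
            have : (-(k : ℂ) + (j : ℂ)) = ((((j : ℝ) - k) * 1 : ℝ) : ℂ) := by
              push_cast
              ring
            rw [this, Complex.norm_real, Real.norm_eq_abs]
            simpa using abs_sub_mul_le_of_mem_range hj zero_le_one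
          rw [zsmul_eq_mul, norm_mul, norm_pow, hc]
          exact mul_le_mul_of_nonneg_left (pow_le_pow_left₀ (norm_nonneg _) hb n)
            (Nat.cast_nonneg _)
      _ = 4 ^ k * k ^ n := by
          rw [← Finset.sum_mul]
          congr 1
          have h2k := Nat.sum_range_choose (2 * k)
          have : (∑ j ∈ Finset.range (2 * k + 1), ((2 * k).choose j : ℝ)) =
              (((2 : ℕ) ^ (2 * k) : ℕ) : ℝ) := by
            rw [← h2k]
            push_cast
            rfl
          rw [this]
          push_cast
          rw [pow_mul]
          norm_num
  -- only the term `n = 2k` survives among `n ≤ 2k`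
  have hhead : ∑ i ∈ Finset.range (2 * k + 1), a i * h ^ i * P i =
      a (2 * k) * h ^ (2 * k) * (2 * k)! := by
    rw [Finset.sum_range_succ, Finset.sum_eq_zero fun i hi => ?_, zero_add, hP_eq]
    rw [hP_lt i (Finset.mem_range.1 hi), mul_zero]
  have htail : HasSum (fun m => a (m + (2 * k + 1)) * h ^ (m + (2 * k + 1)) * P (m + (2 * k + 1)))
      (S - a (2 * k) * h ^ (2 * k) * (2 * k)!) := by
    rw [← hhead]
    exact (hasSum_nat_add_iff' (f := fun n => a n * h ^ n * P n) (2 * k + 1)).2 hsum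
  -- geometric domination of the tail
  set ρ : ℝ := k * h / r with hρ_def
  have hρ0 : 0 ≤ ρ := by positivity
  have hρ1 : ρ ≤ 1 / 2 := by
    rw [hρ_def, div_le_iff₀ hr]
    linarith
  have hterm : ∀ n, ‖a n * h ^ n * P n‖ ≤ 4 ^ k * M * ρ ^ n := fun n => by
    rw [norm_mul, norm_mul, norm_pow, Complex.norm_real, Real.norm_eq_abs, abs_of_pos hh]
    calc ‖a n‖ * h ^ n * ‖P n‖ ≤ M / r ^ n * h ^ n * (4 ^ k * k ^ n) :=
          mul_le_mul (mul_le_mul_of_nonneg_right (ha n) (pow_nonneg hh.le n)) (hP_le n)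
            (norm_nonneg _) (mul_nonneg (div_nonneg hM0 (pow_nonneg hr.le n)) (pow_nonneg hh.le n))
      _ = 4 ^ k * M * ρ ^ n := by
          rw [hρ_def, div_pow, mul_pow]
          field_simp
  have hgeom : HasSum (fun m : ℕ => 4 ^ k * M * ρ ^ (2 * k + 1) * ρ ^ m)
      (4 ^ k * M * ρ ^ (2 * k + 1) * (1 - ρ)⁻¹) :=
    (hasSum_geometric_of_lt_one hρ0 (by linarith)).mul_left _
  have htail_le : ‖S - a (2 * k) * h ^ (2 * k) * (2 * k)!‖ ≤
      4 ^ k * M * ρ ^ (2 * k + 1) * (1 - ρ)⁻¹ := by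
    refine htail.norm_le_of_bounded hgeom fun m => ?_
    calc ‖a (m + (2 * k + 1)) * h ^ (m + (2 * k + 1)) * P (m + (2 * k + 1))‖
        ≤ 4 ^ k * M * ρ ^ (m + (2 * k + 1)) := hterm _
      _ = 4 ^ k * M * ρ ^ (2 * k + 1) * ρ ^ m := by
          rw [pow_add]
          ring
  have htail_le' : ‖S - a (2 * k) * h ^ (2 * k) * (2 * k)!‖ ≤
      2 * 4 ^ k * M * k ^ (2 * k + 1) / r ^ (2 * k + 1) * h ^ (2 * k + 1) := by
    refine htail_le.trans ?_
    have h2 : (1 - ρ)⁻¹ ≤ 2 := by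
      rw [inv_le_comm₀ (by linarith) (by norm_num)]
      linarith
    calc 4 ^ k * M * ρ ^ (2 * k + 1) * (1 - ρ)⁻¹ ≤ 4 ^ k * M * ρ ^ (2 * k + 1) * 2 :=
          mul_le_mul_of_nonneg_left h2 (mul_nonneg (mul_nonneg (by positivity) hM0) (by positivity))
      _ = 2 * 4 ^ k * M * k ^ (2 * k + 1) / r ^ (2 * k + 1) * h ^ (2 * k + 1) := by
          rw [hρ_def, div_pow, mul_pow]
          ring
  -- the main term
  have hfact : ((2 * k)! : ℂ) ≠ 0 := Nat.cast_ne_zero.2 (Nat.factorial_ne_zero _)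
  have hmain : ‖a (2 * k) * h ^ (2 * k) * (2 * k)!‖ ≤ h ^ (2 * k) * ((2 * k)! * M / r ^ (2 * k)) := by
    have : a (2 * k) * h ^ (2 * k) * (2 * k)! = h ^ (2 * k) * iteratedDeriv (2 * k) f 0 := by
      rw [ha_def]
      dsimp only
      rw [show ((2 * k)! : ℂ)⁻¹ * iteratedDeriv (2 * k) f 0 * h ^ (2 * k) * (2 * k)! =
          ((2 * k)! : ℂ)⁻¹ * (2 * k)! * (h ^ (2 * k) * iteratedDeriv (2 * k) f 0) by ring,
        inv_mul_cancel₀ hfact, one_mul]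
    rw [this, norm_mul, norm_pow, Complex.norm_real, Real.norm_eq_abs, abs_of_pos hh]
    exact mul_le_mul_of_nonneg_left (hcauchy _) (by positivity)
  -- conclusion
  calc ‖S‖ ≤ ‖a (2 * k) * h ^ (2 * k) * (2 * k)!‖ + ‖S - a (2 * k) * h ^ (2 * k) * (2 * k)!‖ :=
        norm_le_norm_add_norm_sub' _ _
    _ ≤ h ^ (2 * k) * ((2 * k)! * M / r ^ (2 * k)) +
        2 * 4 ^ k * M * k ^ (2 * k + 1) / r ^ (2 * k + 1) * h ^ (2 * k + 1) :=
        add_le_add hmain htail_le'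
    _ = _ := by ring

/-! ## Even moments via Fatou -/

/-- `(2 - 2cos(hx)) / h² → x²` as `h → 0⁺` (squeeze between `1 - y²/2 ≤ cos y` and
`cos y ≤ 1 - y²/2 + (5/96) y⁴` for `|y| ≤ 1`). [folklore] -/
theorem tendsto_two_sub_two_mul_cos_div_sq (x : ℝ) :
    Tendsto (fun h : ℝ => (2 - 2 * Real.cos (h * x)) / h ^ 2) (𝓝[>] 0) (𝓝 (x ^ 2)) := by
  have hlow : Tendsto (fun h : ℝ => x ^ 2 - 5 / 48 * x ^ 4 * h ^ 2) (𝓝[>] 0) (𝓝 (x ^ 2)) := by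
    have : Tendsto (fun h : ℝ => x ^ 2 - 5 / 48 * x ^ 4 * h ^ 2) (𝓝 0)
        (𝓝 (x ^ 2 - 5 / 48 * x ^ 4 * 0 ^ 2)) :=
      (continuous_const.sub (continuous_const.mul (continuous_pow 2))).tendsto 0
    rw [zero_pow two_ne_zero, mul_zero, sub_zero] at this
    exact this.mono_left nhdsWithin_le_nhds
  have hsmall : ∀ᶠ h : ℝ in 𝓝[>] 0, |h * x| < 1 := by
    have : Tendsto (fun h : ℝ => |h * x|) (𝓝 0) (𝓝 0) := by
      have := ((continuous_id.mul continuous_const).abs : Continuous fun h : ℝ => |h * x|).tendsto 0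
      simpa using this
    exact (this.mono_left nhdsWithin_le_nhds).eventually (Iio_mem_nhds one_pos)
  refine tendsto_of_tendsto_of_tendsto_of_le_of_le' hlow tendsto_const_nhds ?_ ?_
  · filter_upwards [hsmall, self_mem_nhdsWithin] with h hhx hh
    have hh0 : (0 : ℝ) < h := hh
    have hc := (abs_le.1 (Real.cos_bound hhx.le)).2
    have h4 : |h * x| ^ 4 = h ^ 4 * x ^ 4 := by
      rw [← abs_pow, abs_of_nonneg (by positivity), mul_pow]
    have h2 : (h * x) ^ 2 = h ^ 2 * x ^ 2 := by ring
    rw [h4, h2] at hc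
    rw [le_div_iff₀ (by positivity)]
    nlinarith [hc]
  · filter_upwards [self_mem_nhdsWithin] with h hh
    have hh0 : (0 : ℝ) < h := hh
    rw [div_le_iff₀ (by positivity)]
    have h1 := Real.one_sub_sq_div_two_le_cos (x := h * x)
    have h2 : (h * x) ^ 2 = h ^ 2 * x ^ 2 := by ring
    nlinarith [h1, h2]

/-- **Even moments of a measure with analytic characteristic function (Cauchy-estimate form).**
Let `ν` be a finite measure on `ℝ` whose characteristic function agrees on `(-t, t)` with a
function `f` holomorphic on the disc `|z| < t` and bounded there by `M`. Then for `0 < r < t` and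
every `k`, `∫ x^{2k} dν ≤ (2k)! · M / r^{2k}` (in particular all moments are finite). Proof:
Fatou's lemma applied to `((2 - 2cos(hx))/h²)^k → x^{2k}` (`h → 0⁺`), whose integral is
`h^{-2k} |Σ_j (-1)^{2k-j} (2k choose j) f((j-k)h)| ≤ (2k)! M / r^{2k} + O(h)`
(`sum_centralDiff_charFun`, `norm_sum_centralDiff_le`). (Lukacs, *Characteristic Functions*,
2nd ed. 1970, Thm. 7.1.1 and its proof.) [folklore] -/
theorem lintegral_pow_le_of_charFun_eq (ν : Measure ℝ) [IsFiniteMeasure ν] {t M : ℝ} {f : ℂ → ℂ}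
    (hf : DifferentiableOn ℂ f (ball 0 t)) (hM : ∀ z ∈ ball (0 : ℂ) t, ‖f z‖ ≤ M)
    (hfν : ∀ b : ℝ, |b| < t → f b = charFun ν b) {r : ℝ} (hr : 0 < r) (hrt : r < t) (k : ℕ) :
    ∫⁻ x, ENNReal.ofReal (x ^ (2 * k)) ∂ν ≤ ENNReal.ofReal ((2 * k)! * M / r ^ (2 * k)) := by
  set B : ℝ := (2 * k)! * M / r ^ (2 * k) with hB
  set C : ℝ := 2 * 4 ^ k * M * k ^ (2 * k + 1) / r ^ (2 * k + 1) with hC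
  obtain ⟨G, hG⟩ : ∃ G : ℝ → ℝ → ℝ≥0∞,
      G = fun h x => ENNReal.ofReal (((2 - 2 * Real.cos (h * x)) / h ^ 2) ^ k) := ⟨_, rfl⟩
  -- (1) pointwise convergence `G h x → x^{2k}` as `h → 0⁺`
  have hlim : ∀ x : ℝ, Tendsto (fun h => G h x) (𝓝[>] 0) (𝓝 (ENNReal.ofReal (x ^ (2 * k)))) := by
    intro x
    have := (ENNReal.continuous_ofReal.tendsto _).comp
      ((tendsto_two_sub_two_mul_cos_div_sq x).pow k)
    rw [← pow_mul] at this
    rw [hG]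
    exact this
  -- (2) Fatou
  have hmeas : ∀ h, Measurable (G h) := fun h => by
    rw [hG]
    exact ENNReal.measurable_ofReal.comp (by fun_prop)
  have hFatou : ∫⁻ x, ENNReal.ofReal (x ^ (2 * k)) ∂ν ≤
      liminf (fun h => ∫⁻ x, G h x ∂ν) (𝓝[>] 0) :=
    calc ∫⁻ x, ENNReal.ofReal (x ^ (2 * k)) ∂ν = ∫⁻ x, liminf (fun h => G h x) (𝓝[>] 0) ∂ν :=
          lintegral_congr fun x => ((hlim x).liminf_eq).symm
      _ ≤ _ := lintegral_liminf_le' fun h => (hmeas h).aemeasurable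
  -- (3) the bound on `∫⁻ G h` for small `h > 0`
  have hbound : ∀ᶠ h : ℝ in 𝓝[>] 0, ∫⁻ x, G h x ∂ν ≤ ENNReal.ofReal (B + C * h) := by
    have hsmall : ∀ᶠ h : ℝ in 𝓝[>] 0, h < r / (2 * k + 1) :=
      mem_nhdsWithin_of_mem_nhds (Iio_mem_nhds (by positivity))
    filter_upwards [hsmall, self_mem_nhdsWithin] with h hhr hh
    have hh0 : (0 : ℝ) < h := hh
    have hkh : 2 * k * h ≤ r := by
      rw [lt_div_iff₀ (by positivity)] at hhr
      nlinarith
    have hnn : ∀ x, 0 ≤ ((2 - 2 * Real.cos (h * x)) / h ^ 2) ^ k := fun x =>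
      pow_nonneg (div_nonneg (by linarith [Real.cos_le_one (h * x)]) (sq_nonneg h)) k
    have hint : Integrable (fun x => ((2 - 2 * Real.cos (h * x)) / h ^ 2) ^ k) ν := by
      refine (integrable_const ((4 / h ^ 2) ^ k)).mono'
        (Continuous.aestronglyMeasurable (by fun_prop)) (ae_of_all _ fun x => ?_)
      rw [Real.norm_of_nonneg (hnn x)]
      gcongr
      · exact div_nonneg (by linarith [Real.cos_le_one (h * x)]) (sq_nonneg h)
      · linarith [Real.neg_one_le_cos (h * x)]
    have h1 : ∫⁻ x, G h x ∂ν =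
        ENNReal.ofReal (∫ x, ((2 - 2 * Real.cos (h * x)) / h ^ 2) ^ k ∂ν) := by
      rw [hG]
      exact (ofReal_integral_eq_lintegral_ofReal hint (ae_of_all _ hnn)).symm
    rw [h1]
    refine ENNReal.ofReal_le_ofReal ?_
    have h2 : ∫ x, ((2 - 2 * Real.cos (h * x)) / h ^ 2) ^ k ∂ν =
        (∫ x, (2 - 2 * Real.cos (h * x)) ^ k ∂ν) / h ^ (2 * k) := by
      simp_rw [div_pow, ← pow_mul]
      exact integral_div _ _
    have h3 : ∫ x, (2 - 2 * Real.cos (h * x)) ^ k ∂ν =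
        ‖∑ j ∈ Finset.range (2 * k + 1), ((-1 : ℂ) ^ (2 * k - j) * ((2 * k).choose j : ℂ)) *
            f ((((j : ℝ) - k) * h : ℝ) : ℂ)‖ := by
      have hS : ∑ j ∈ Finset.range (2 * k + 1),
            ((-1 : ℂ) ^ (2 * k - j) * ((2 * k).choose j : ℂ)) * f ((((j : ℝ) - k) * h : ℝ) : ℂ) =
          (-1) ^ k * ((∫ x, (2 - 2 * Real.cos (h * x)) ^ k ∂ν : ℝ) : ℂ) := by
        rw [← sum_centralDiff_charFun ν h k]
        refine Finset.sum_congr rfl fun j hj => ?_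
        rw [hfν]
        calc |((j : ℝ) - k) * h| ≤ k * h := abs_sub_mul_le_of_mem_range hj hh0.le
          _ < t := by nlinarith
      rw [hS, norm_mul, norm_pow, norm_neg, norm_one, one_pow, one_mul, Complex.norm_real,
        Real.norm_of_nonneg (integral_nonneg fun x => pow_nonneg
          (by linarith [Real.cos_le_one (h * x)]) k)]
    rw [h2, h3, div_le_iff₀ (by positivity)]
    refine (norm_sum_centralDiff_le hf hM hr hrt k hh0 hkh).trans_eq ?_
    rw [hB, hC]
    ring
  -- (4) conclusion
  have hBC : Tendsto (fun h : ℝ => ENNReal.ofReal (B + C * h)) (𝓝[>] 0)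
      (𝓝 (ENNReal.ofReal B)) := by
    have : Tendsto (fun h : ℝ => B + C * h) (𝓝 0) (𝓝 (B + C * 0)) :=
      (continuous_const.add (continuous_const.mul continuous_id)).tendsto 0
    rw [mul_zero, add_zero] at this
    exact (ENNReal.continuous_ofReal.tendsto B).comp (this.mono_left nhdsWithin_le_nhds)
  calc ∫⁻ x, ENNReal.ofReal (x ^ (2 * k)) ∂ν ≤ liminf (fun h => ∫⁻ x, G h x ∂ν) (𝓝[>] 0) :=
        hFatou
    _ ≤ liminf (fun h : ℝ => ENNReal.ofReal (B + C * h)) (𝓝[>] 0) := liminf_le_liminf hbound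
    _ = ENNReal.ofReal B := hBC.liminf_eq

/-! ## Exponential moments -/

/-- **Analytic characteristic function ⇒ exponential moments** (Lukacs 1970, Thm. 7.1.1): if the
characteristic function of the finite measure `ν` on `ℝ` agrees on `(-t, t)` with a function
holomorphic and bounded on the disc `|z| < t`, then `∫ e^{σx} dν(x) < ∞` for every `|σ| < t`.
Proof: `e^{σx} ≤ 2cosh(σx) = 2 Σ_k (σx)^{2k}/(2k)!` and the moment bounds
`∫ x^{2k} ≤ (2k)! M / r^{2k}` (`lintegral_pow_le_of_charFun_eq`, `|σ| < r < t`) sum to the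
geometric series `2M Σ (σ/r)^{2k}`. [folklore] -/
theorem lintegral_exp_mul_lt_top_of_charFun_eq (ν : Measure ℝ) [IsFiniteMeasure ν] {t M : ℝ}
    {f : ℂ → ℂ} (hf : DifferentiableOn ℂ f (ball 0 t)) (hM : ∀ z ∈ ball (0 : ℂ) t, ‖f z‖ ≤ M)
    (hfν : ∀ b : ℝ, |b| < t → f b = charFun ν b) {σ : ℝ} (hσ : |σ| < t) :
    ∫⁻ x, ENNReal.ofReal (Real.exp (σ * x)) ∂ν < ∞ := by
  obtain ⟨r, hσr, hrt⟩ := exists_between hσ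
  have hr : 0 < r := (abs_nonneg σ).trans_lt hσr
  have hM0 : 0 ≤ M := (norm_nonneg _).trans (hM 0 (mem_ball_self (hr.trans hrt)))
  have hmom := fun k => lintegral_pow_le_of_charFun_eq ν hf hM hfν hr hrt k
  set ρ : ℝ := (σ / r) ^ 2 with hρ
  have hρ0 : 0 ≤ ρ := sq_nonneg _
  have hρ1 : ρ < 1 := by
    rw [hρ, sq_lt_one_iff_abs_lt_one, abs_div, abs_of_pos hr, div_lt_one hr]
    exact hσr
  -- pointwise: `e^{σx} ≤ 2 cosh(σx) = 2 Σ (σx)^{2k}/(2k)!`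
  have hpt : ∀ x : ℝ, ENNReal.ofReal (Real.exp (σ * x)) ≤
      2 * ∑' n : ℕ, ENNReal.ofReal (σ ^ (2 * n) / (2 * n)!) * ENNReal.ofReal (x ^ (2 * n)) := by
    intro x
    have hcosh := Real.hasSum_cosh (σ * x)
    have hle : Real.exp (σ * x) ≤ 2 * Real.cosh (σ * x) := by
      rw [Real.cosh_eq]
      linarith [Real.exp_pos (-(σ * x))]
    calc ENNReal.ofReal (Real.exp (σ * x)) ≤ ENNReal.ofReal (2 * Real.cosh (σ * x)) :=
          ENNReal.ofReal_le_ofReal hle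
      _ = 2 * ENNReal.ofReal (Real.cosh (σ * x)) := by
          rw [ENNReal.ofReal_mul zero_le_two, ENNReal.ofReal_ofNat]
      _ = 2 * ∑' n : ℕ, ENNReal.ofReal ((σ * x) ^ (2 * n) / (2 * n)!) := by
          rw [← hcosh.tsum_eq, ENNReal.ofReal_tsum_of_nonneg
            (fun n => div_nonneg (by rw [pow_mul]; positivity) (Nat.cast_nonneg _))
            hcosh.summable]
      _ = 2 * ∑' n : ℕ, ENNReal.ofReal (σ ^ (2 * n) / (2 * n)!) * ENNReal.ofReal (x ^ (2 * n)) := by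
          congr 1
          refine tsum_congr fun n => ?_
          rw [← ENNReal.ofReal_mul (div_nonneg (by rw [pow_mul]; positivity) (Nat.cast_nonneg _))]
          congr 1
          rw [mul_pow]
          ring
  have hmeas : ∀ n : ℕ, Measurable fun x : ℝ =>
      ENNReal.ofReal (σ ^ (2 * n) / (2 * n)!) * ENNReal.ofReal (x ^ (2 * n)) := fun n =>
    measurable_const.mul (ENNReal.measurable_ofReal.comp (measurable_id.pow_const _))
  calc ∫⁻ x, ENNReal.ofReal (Real.exp (σ * x)) ∂ν
      ≤ ∫⁻ x, 2 * ∑' n : ℕ, ENNReal.ofReal (σ ^ (2 * n) / (2 * n)!) *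
          ENNReal.ofReal (x ^ (2 * n)) ∂ν := lintegral_mono hpt
    _ = 2 * ∑' n : ℕ, ENNReal.ofReal (σ ^ (2 * n) / (2 * n)!) *
          ∫⁻ x, ENNReal.ofReal (x ^ (2 * n)) ∂ν := by
        rw [lintegral_const_mul' _ _ ENNReal.ofNat_ne_top,
          lintegral_tsum fun n => (hmeas n).aemeasurable]
        congr 1
        refine tsum_congr fun n => ?_
        rw [lintegral_const_mul' _ _ ENNReal.ofReal_ne_top]
    _ ≤ 2 * ∑' n : ℕ, ENNReal.ofReal (σ ^ (2 * n) / (2 * n)!) *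
          ENNReal.ofReal ((2 * n)! * M / r ^ (2 * n)) := by
        gcongr with n
        exact hmom n
    _ = 2 * ∑' n : ℕ, ENNReal.ofReal (M * ρ ^ n) := by
        congr 1
        refine tsum_congr fun n => ?_
        rw [← ENNReal.ofReal_mul (div_nonneg (by rw [pow_mul]; positivity) (Nat.cast_nonneg _))]
        congr 1
        rw [hρ, ← pow_mul, div_pow]
        field_simp
    _ = 2 * ENNReal.ofReal (∑' n : ℕ, M * ρ ^ n) := by
        rw [ENNReal.ofReal_tsum_of_nonneg (fun n => mul_nonneg hM0 (pow_nonneg hρ0 n))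
          ((summable_geometric_of_lt_one hρ0 hρ1).mul_left M)]
    _ < ∞ := ENNReal.mul_lt_top (by simp) ENNReal.ofReal_lt_top

/-- **Analytic characteristic function ⇒ exponential moments**, `Integrable` form: under the
hypotheses of `lintegral_exp_mul_lt_top_of_charFun_eq`, `x ↦ e^{σx}` is `ν`-integrable for
`|σ| < t` (Lukacs 1970, Thm. 7.1.1). [folklore] -/
theorem integrable_exp_mul_of_charFun_eq (ν : Measure ℝ) [IsFiniteMeasure ν] {t M : ℝ}
    {f : ℂ → ℂ} (hf : DifferentiableOn ℂ f (ball 0 t)) (hM : ∀ z ∈ ball (0 : ℂ) t, ‖f z‖ ≤ M)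
    (hfν : ∀ b : ℝ, |b| < t → f b = charFun ν b) {σ : ℝ} (hσ : |σ| < t) :
    Integrable (fun x => Real.exp (σ * x)) ν :=
  ⟨Continuous.aestronglyMeasurable (by fun_prop),
    (hasFiniteIntegral_iff_ofReal (ae_of_all _ fun x => (Real.exp_pos _).le)).2
      (lintegral_exp_mul_lt_top_of_charFun_eq ν hf hM hfν hσ)⟩

/-- Under the hypotheses of `lintegral_exp_mul_lt_top_of_charFun_eq`, the interval `(-t, t)` is
contained in Mathlib's `integrableExpSet id ν` (the set of `σ` with `e^{σx}` integrable), hence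
in its interior. [folklore] -/
theorem Ioo_subset_interior_integrableExpSet_of_charFun_eq (ν : Measure ℝ) [IsFiniteMeasure ν]
    {t M : ℝ} {f : ℂ → ℂ} (hf : DifferentiableOn ℂ f (ball 0 t))
    (hM : ∀ z ∈ ball (0 : ℂ) t, ‖f z‖ ≤ M) (hfν : ∀ b : ℝ, |b| < t → f b = charFun ν b) :
    Set.Ioo (-t) t ⊆ interior (integrableExpSet id ν) :=
  interior_maximal (fun _ hσ => integrable_exp_mul_of_charFun_eq ν hf hM hfν (abs_lt.2 hσ))
    isOpen_Ioo

/-! ## Identification with the holomorphic extension, and the uniform bound -/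

/-- **The holomorphic function on the disc is the Fourier–Laplace transform.** Under the
hypotheses of `lintegral_exp_mul_lt_top_of_charFun_eq` (with `0 < t`), for every `z` in the disc
`|z| < t` one has `∫ e^{izx} dν(x) = f(z)`, i.e. `complexMGF id ν (z I) = f z`: both sides are
holomorphic on the disc (the left side on the whole strip `|Im z| < t`, by the exponential moments
and Mathlib's `analyticOnNhd_complexMGF`) and they agree on the real diameter, so the identity
theorem applies. (Lukacs 1970, Thm. 7.1.1: "the characteristic function is analytic in the
strip and is there represented by the Fourier integral".) [folklore] -/
theorem complexMGF_mul_I_eq_of_charFun_eq (ν : Measure ℝ) [IsFiniteMeasure ν] {t M : ℝ}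
    {f : ℂ → ℂ} (ht : 0 < t) (hf : DifferentiableOn ℂ f (ball 0 t))
    (hM : ∀ z ∈ ball (0 : ℂ) t, ‖f z‖ ≤ M) (hfν : ∀ b : ℝ, |b| < t → f b = charFun ν b)
    {z : ℂ} (hz : z ∈ ball (0 : ℂ) t) :
    complexMGF id ν (z * Complex.I) = f z := by
  have hsub := Ioo_subset_interior_integrableExpSet_of_charFun_eq ν hf hM hfν
  -- `β ↦ complexMGF id ν (β I)` is analytic on the disc
  have hF : AnalyticOnNhd ℂ (fun β : ℂ => complexMGF id ν (β * Complex.I)) (ball 0 t) := by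
    have h1 : AnalyticOnNhd ℂ (complexMGF id ν) {w | w.re ∈ interior (integrableExpSet id ν)} :=
      analyticOnNhd_complexMGF
    have h2 : AnalyticOnNhd ℂ (fun β : ℂ => β * Complex.I) (ball 0 t) :=
      fun β _ => analyticAt_id.mul analyticAt_const
    refine h1.comp h2 fun β hβ => ?_
    apply hsub
    have him := (Complex.abs_im_le_norm β).trans_lt (mem_ball_zero_iff.1 hβ)
    rw [abs_lt] at him
    simp only [Complex.mul_re, Complex.I_re, mul_zero, Complex.I_im, mul_one, zero_sub,
      Set.mem_Ioo]
    constructor <;> linarith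
  have hfa : AnalyticOnNhd ℂ f (ball 0 t) := hf.analyticOnNhd isOpen_ball
  -- they agree along the reals near `0`
  have hfreq : ∃ᶠ w in 𝓝[≠] (0 : ℂ), complexMGF id ν (w * Complex.I) = f w := by
    have htend : Tendsto (fun b : ℝ => (b : ℂ)) (𝓝[≠] 0) (𝓝[≠] 0) := by
      refine tendsto_nhdsWithin_iff.2 ⟨?_, ?_⟩
      · have := (Complex.continuous_ofReal.tendsto 0)
        rw [Complex.ofReal_zero] at this
        exact this.mono_left nhdsWithin_le_nhds
      · filter_upwards [self_mem_nhdsWithin] with b hb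
        simpa using hb
    have hev : ∀ᶠ b : ℝ in 𝓝[≠] 0, complexMGF id ν ((b : ℂ) * Complex.I) = f b := by
      have h0 : ∀ᶠ b : ℝ in 𝓝 0, |b| < t := by
        have : Set.Ioo (-t) t ∈ 𝓝 (0 : ℝ) := Ioo_mem_nhds (by linarith) ht
        filter_upwards [this] with b hb using abs_lt.2 hb
      filter_upwards [mem_nhdsWithin_of_mem_nhds h0] with b hb
      rw [complexMGF_id_mul_I, hfν b hb]
    exact htend.frequently hev.frequently
  exact hF.eqOn_of_preconnected_of_frequently_eq hfa (convex_ball 0 t).isPreconnected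
    (mem_ball_self ht) hfreq hz

/-- **Laplace transform = holomorphic extension at imaginary points; the uniform bound.** Under
the hypotheses of `complexMGF_mul_I_eq_of_charFun_eq`, for real `σ` with `|σ| < t`:
`∫ e^{σx} dν(x) = f(-iσ)` (as a complex number, `↑(mgf id ν σ) = f (-σ I)`), hence
`∫ e^{σx} dν ≤ M`. [folklore] -/
theorem mgf_le_of_charFun_eq (ν : Measure ℝ) [IsFiniteMeasure ν] {t M : ℝ} {f : ℂ → ℂ}
    (ht : 0 < t) (hf : DifferentiableOn ℂ f (ball 0 t)) (hM : ∀ z ∈ ball (0 : ℂ) t, ‖f z‖ ≤ M)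
    (hfν : ∀ b : ℝ, |b| < t → f b = charFun ν b) {σ : ℝ} (hσ : |σ| < t) :
    (mgf id ν σ : ℂ) = f (-(σ : ℂ) * Complex.I) ∧ mgf id ν σ ≤ M := by
  have hz : (-(σ : ℂ) * Complex.I) ∈ ball (0 : ℂ) t := by
    rw [mem_ball_zero_iff, norm_mul, norm_neg, Complex.norm_real, Complex.norm_I, mul_one,
      Real.norm_eq_abs]
    exact hσ
  have h1 := complexMGF_mul_I_eq_of_charFun_eq ν ht hf hM hfν hz
  have h2 : -(σ : ℂ) * Complex.I * Complex.I = σ := by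
    rw [mul_assoc, Complex.I_mul_I]
    ring
  rw [h2, complexMGF_ofReal] at h1
  refine ⟨h1, ?_⟩
  calc mgf id ν σ = ‖(mgf id ν σ : ℂ)‖ := by
        rw [Complex.norm_real, Real.norm_of_nonneg (mgf_nonneg)]
    _ = ‖f (-(σ : ℂ) * Complex.I)‖ := by rw [h1]
    _ ≤ M := hM _ hz

/-- **Uniform bound on the two-sided Laplace transform, `ℝ≥0∞` form.** Under the hypotheses of
`complexMGF_mul_I_eq_of_charFun_eq`: `∫⁻ e^{σx} dν ≤ M` for every `|σ| < t` (the form used for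
ray/cone-support arguments, where no integrability bookkeeping is wanted). [folklore] -/
theorem lintegral_exp_mul_le_of_charFun_eq (ν : Measure ℝ) [IsFiniteMeasure ν] {t M : ℝ}
    {f : ℂ → ℂ} (ht : 0 < t) (hf : DifferentiableOn ℂ f (ball 0 t))
    (hM : ∀ z ∈ ball (0 : ℂ) t, ‖f z‖ ≤ M) (hfν : ∀ b : ℝ, |b| < t → f b = charFun ν b)
    {σ : ℝ} (hσ : |σ| < t) :
    ∫⁻ x, ENNReal.ofReal (Real.exp (σ * x)) ∂ν ≤ ENNReal.ofReal M := by
  rw [← ofReal_integral_eq_lintegral_ofReal (integrable_exp_mul_of_charFun_eq ν hf hM hfν hσ)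
    (ae_of_all _ fun x => (Real.exp_pos _).le)]
  refine ENNReal.ofReal_le_ofReal ?_
  have := (mgf_le_of_charFun_eq ν ht hf hM hfν hσ).2
  simpa only [mgf, id_eq] using this

/-- **Uniform bound on the two-sided Laplace transform, Bochner form.** Under the hypotheses of
`complexMGF_mul_I_eq_of_charFun_eq`: `∫ e^{σx} dν ≤ M` for every `|σ| < t` (the integrand is
integrable by `integrable_exp_mul_of_charFun_eq`). [folklore] -/
theorem integral_exp_mul_le_of_charFun_eq (ν : Measure ℝ) [IsFiniteMeasure ν] {t M : ℝ}
    {f : ℂ → ℂ} (ht : 0 < t) (hf : DifferentiableOn ℂ f (ball 0 t))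
    (hM : ∀ z ∈ ball (0 : ℂ) t, ‖f z‖ ≤ M) (hfν : ∀ b : ℝ, |b| < t → f b = charFun ν b)
    {σ : ℝ} (hσ : |σ| < t) :
    ∫ x, Real.exp (σ * x) ∂ν ≤ M := by
  have := (mgf_le_of_charFun_eq ν ht hf hM hfν hσ).2
  simpa only [mgf, id_eq] using this

end Literature.Probability.Moments
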